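import Summits.BirchSwinnertonDyer.BirchSwinnertonDyer.Theorems.PrintCf2RamifiedOffTYZHalfMover
import Literature.NumberTheory.EllipticCurves.TianYuanZhang2017.CMPointFrobeniusDisplays
import Literature.NumberTheory.EllipticCurves.CongruentNumberMonskySelmerParitySelmer
import HarnessLib

/-!
# Crux `PrintCf2.RamifiedOffTYZOfFacts` (stmt-BirchSwinnertonDyer-20509), line `offtyz-v7`, LEAD cycle 12 (cruxlead-20509 g11):
# THE LOWER HALF OF C⁺ ON THE STRATUM `ρ(n) = 1` OF THE ODD `s ≥ 2` CLASS, FROM THE NAMED FACTS —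
# `tyz_cmPointRingClassFrobeniusData ∧ thm11_parity_of_scriptL ∧ GZK ⟹ ∀ odd square-free n ≡ 5, 7 (8) with ord_{s=1} L(E_n,s) = 1, #Sel₂(E_n) = 2^{2+s}
# (s ≥ 2) and a generator R = (x, y) of E_n(ℚ) mod torsion with x ∉ {±1, ±n}·ℚ^{×2}: 𝓛(n) is EVEN`

THEOREMS ONLY (no `def`, no `sorry`), `--supports stmt-BirchSwinnertonDyer-20509` — the `OfFacts` packaging of this seat's `…LowerHalfDoor` §3 /
`…HalfMover` §4 on the named printed facts they use (pattern of g7's `…SelmerRankOneOfFacts`, p694796):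
* `TianYuanZhang2017.tyz_cmPointRingClassFrobeniusData` — TYZ 2017 §3 AS PRINTED (genus-point displays `Printed`, CM-point layer, conductor-2/4 ring class
  dictionary, Frobenius elements; `CMPointFrobeniusDisplays.lean`, p691528);
* `TianYuanZhang2017.thm11_parity_of_scriptL` — TYZ Thm 1.1 (parity of `𝓛(m)`, `m ≡ 1 (8)`);
* `rank_eq_analyticRank_of_analyticRank_le_one` — GZK (conjunct 1 of 𝔅_ram).
`ρ(n) = 1` is carried in its explicit descent form «the generator's abscissa `x(R) ∉ {1, −1, n, −n}·ℚ^{×2}`» (Silverman X.4.9).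
What is proved: the Ш-SIDE DIRECTION («Selmer excess ⟹ analytic Ш even») that BSD₂ demands and Tian–Yuan–Zhang's Thm 1.2 does not state, on the
stratum `ρ = 1`; mechanism `…LowerHalfDoor`: were `𝓛(n)` odd, the square of the half-mover would move `P(n)` by `τ(1)`, against the Layer-1 silence of
squares at `s ≥ 2` (g10, p722669).  BSD is not proved by any of this; no route item is closed by this file (helper toward 23431/20509; the planner may file
the `OfFacts` statement, which `two_dvd_scriptL_rhoOne_odd_of_facts` closes by name).

References: [cite: TianYuanZhang2017, Thm. 1.1, Thm. 1.2, §1 (ρ(n)), §3 (Prop. 3.2, Thm. 3.5, Thm. 3.6, Lemma 3.18, Lemma 3.21)];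
[cite: HeathBrown1994SelmerCongruentII, Appendix (Monsky)]; [cite: SilvermanAEC2009, X.4.9]; [cite: Darmon2004, Thm. 3.22]; [cite: Cox2013, §5.C, §9.A].
-/

noncomputable section

open scoped Classical

open WeierstrassCurve WeierstrassCurve.Affine Literature.NumberTheory.EllipticCurves Literature.NumberTheory.EllipticCurves.TianYuanZhang2017
  Literature.NumberTheory.EllipticCurves.TianYuanZhang2017.W2
  Literature.NumberTheory.EllipticCurves.MonskySelmerParity
  Literature.NumberTheory.QuadraticFields.RingClass Literature.NumberTheory.QuadraticFields
  Summit.BirchSwinnertonDyer.PrintCf2.HalfMover Summit.BirchSwinnertonDyer.PrintCf2.LowerHalfDoor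

set_option autoImplicit false

namespace Summit.BirchSwinnertonDyer.PrintCf2.LowerHalfRhoOne

variable {n : ℕ}

/-! ## §1 Display shape -/

/-- **THE LOWER HALF ON `{ρ = 1}`, display shape.**  Square-free ODD `n ≡ 5, 7 (mod 8)` of analytic rank one, GZK; data `D : GenusPointData n` with
`D.Printed` and the CM-point / ring-class / Frobenius package `D.CMPointRingClassFrobeniusPrinted`; TYZ Thm 1.1; `#Sel₂(E_n/ℚ) = 2^{2+s}`, `s ≥ 2`; a
generator `R = (x, y)` of `E_n(ℚ)` modulo torsion with `x ∉ {1, −1, n, −n}·ℚ^{×2}`.  Then `2 ∣ L` for every integer `L` with `𝓛(n)² = L²`.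
[cite: TianYuanZhang2017, Thm. 1.1 and §3 (Prop. 3.2 (1), Thm. 3.5, Thm. 3.6 (1), Lemma 3.18, proof of Lemma 3.21), §1 (p0002 L101–L110)]
[cite: HeathBrown1994SelmerCongruentII, Appendix (Monsky), typescript p. 39 L10–L41] [cite: Darmon2004, Thm. 3.22] -/
theorem two_dvd_scriptL_rhoOne_odd_of_displays (hGZK : rank_eq_analyticRank_of_analyticRank_le_one)
    (hsq : Squarefree n) (h57 : n % 8 = 5 ∨ n % 8 = 7)
    (hr : haveI := isElliptic_congruentNumberCurve hsq.ne_zero; (congruentNumberCurve n).analyticRank = 1)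
    (D : GenusPointData n) (hPr : D.Printed) (hCM : D.CMPointRingClassFrobeniusPrinted) (h11 : thm11_parity_of_scriptL)
    {s : ℕ} (hs : 2 ≤ s)
    (hsel : haveI := isElliptic_congruentNumberCurve hsq.ne_zero; Nat.card ((congruentNumberCurve n).selmerGroup 2) = 2 ^ (2 + s))
    {x y : ℚ} (hxy : (congruentNumberCurve n).toAffine.Nonsingular x y)
    (hR : haveI := isElliptic_congruentNumberCurve hsq.ne_zero;
      ∀ P, ∃ m : ℤ, IsOfFinAddOrder (P - m • (Point.some x y hxy : (congruentNumberCurve n).toAffine.Point)))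
    (hx : ¬ ∃ q : ℚ, x = q ^ 2 ∨ x = -q ^ 2 ∨ x = n * q ^ 2 ∨ x = -(n * q ^ 2)) :
    ∀ L : ℤ, IsScriptL n L → (2 : ℤ) ∣ L := by
  haveI := isElliptic_congruentNumberCurve hsq.ne_zero
  have hodd : Odd n := by rcases h57 with h | h <;> exact Nat.odd_iff.mpr (by omega)
  obtain ⟨k, p, hp, hp2, hinj, hprod⟩ := exists_odd_prime_family_of_squarefree hsq hodd
  have hpodd : ∀ i, Odd (p i) := fun i => (hp i).odd_of_ne_two (hp2 i)
  obtain ⟨z, Φ, ΓH, ΓH', σ, θ, c, ρ₂, ρ₄, hc, hall⟩ := hCM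
  obtain ⟨hLs, -, hrec, -, h35, -, -, -, h318, -, -⟩ := hPr
  exact two_dvd_scriptL_of_x_not_mem_of_card_selmer_odd p hp hpodd hinj D hGZK hsq hprod.symm h57 hr hrec hLs h35 h318 z Φ ΓH ΓH' σ c ρ₂ hc
    (fun d hd => ⟨(hall d hd).1, (hall d hd).2.2.1⟩) (fun d hd h5d => (hall d hd).2.2.2.1 h5d)
    (fun d hd h5d => (hall d hd).2.2.2.2.2 h5d) h11 hs hsel hxy hR hx

/-- **ON THE ODD JUMP-ONE CLASS WITH `ρ = 1`, C⁺ IS «`P(n)` IS MOVED BY `Gal(ℍ′_n/K_n(i))`», display shape** (same data, `#Sel₂(E_n) = 2⁵`): the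
conclusion of C⁺ at `n` holds iff some `g ∈ Aut_ℚ(ℍ′_n)` fixing `i` and `√−n` has `g·P(n) ≠ P(n)`.
[cite: TianYuanZhang2017, Thm. 1.1 and §3 (Prop. 3.2 (1), Thm. 3.5, Thm. 3.6 (1), Lemma 3.18, proof of Lemma 3.21), §1 (p0002 L101–L110)]
[cite: HeathBrown1994SelmerCongruentII, Appendix (Monsky), typescript p. 39 L10–L41] [cite: Darmon2004, Thm. 3.22] -/
theorem levelTwo_iff_exists_galPt_ne_rhoOne_odd_of_displays (hGZK : rank_eq_analyticRank_of_analyticRank_le_one)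
    (hsq : Squarefree n) (h57 : n % 8 = 5 ∨ n % 8 = 7)
    (hr : haveI := isElliptic_congruentNumberCurve hsq.ne_zero; (congruentNumberCurve n).analyticRank = 1)
    (D : GenusPointData n) (hPr : D.Printed) (hCM : D.CMPointRingClassFrobeniusPrinted) (h11 : thm11_parity_of_scriptL)
    (hsel : haveI := isElliptic_congruentNumberCurve hsq.ne_zero; Nat.card ((congruentNumberCurve n).selmerGroup 2) = 2 ^ 5)
    {x y : ℚ} (hxy : (congruentNumberCurve n).toAffine.Nonsingular x y)
    (hR : haveI := isElliptic_congruentNumberCurve hsq.ne_zero;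
      ∀ P, ∃ m : ℤ, IsOfFinAddOrder (P - m • (Point.some x y hxy : (congruentNumberCurve n).toAffine.Point)))
    (hx : ¬ ∃ q : ℚ, x = q ^ 2 ∨ x = -q ^ 2 ∨ x = n * q ^ 2 ∨ x = -(n * q ^ 2)) :
    (∀ L : ℤ, IsScriptL n L → (2 : ℤ) ∣ L ∧ ¬ (4 : ℤ) ∣ L) ↔
      ∃ g : D.H ≃ₐ[ℚ] D.H, g D.im = D.im ∧ g (D.sqrtNeg n) = D.sqrtNeg n ∧ D.galPt g (D.P n) ≠ D.P n := by
  haveI := isElliptic_congruentNumberCurve hsq.ne_zero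
  have hodd : Odd n := by rcases h57 with h | h <;> exact Nat.odd_iff.mpr (by omega)
  obtain ⟨k, p, hp, hp2, hinj, hprod⟩ := exists_odd_prime_family_of_squarefree hsq hodd
  have hpodd : ∀ i, Odd (p i) := fun i => (hp i).odd_of_ne_two (hp2 i)
  obtain ⟨z, Φ, ΓH, ΓH', σ, θ, c, ρ₂, ρ₄, hc, hall⟩ := hCM
  obtain ⟨hLs, -, hrec, -, h35, -, -, -, h318, -, -⟩ := hPr
  exact levelTwo_iff_exists_galPt_genusPoint_ne_of_x_not_mem p hp hpodd hinj D hGZK hsq hprod.symm h57 hr hrec hLs h35 h318 z Φ ΓH ΓH' σ c ρ₂ hc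
    (fun d hd => ⟨(hall d hd).1, (hall d hd).2.2.1⟩) (fun d hd h5d => (hall d hd).2.2.2.1 h5d)
    (fun d hd h5d => (hall d hd).2.2.2.2.2 h5d) h11 hsel hxy hR hx

/-! ## §2 From the named facts -/

/-- **THE LOWER HALF ON `{ρ = 1}` FROM THE NAMED FACTS.**  Granted TYZ 2017 §3 as printed with the Frobenius package (`tyz_cmPointRingClassFrobeniusData`),
TYZ Thm 1.1 (`thm11_parity_of_scriptL`) and GZK: for every square-free odd `n ≡ 5, 7 (mod 8)` with `ord_{s=1} L(E_n, s) = 1`, `#Sel₂(E_n/ℚ) = 2^{2+s}`,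
`s ≥ 2`, and a generator `R = (x, y)` of `E_n(ℚ)` modulo torsion with `x ∉ {1, −1, n, −n}·ℚ^{×2}`: `2 ∣ L` whenever `𝓛(n)² = L²`.
[cite: TianYuanZhang2017, Thm. 1.1, §1 (ρ(n)) and §3] [cite: HeathBrown1994SelmerCongruentII, Appendix (Monsky)] [cite: Darmon2004, Thm. 3.22] -/
theorem two_dvd_scriptL_rhoOne_odd_of_facts' (hF : tyz_cmPointRingClassFrobeniusData) (h11 : thm11_parity_of_scriptL)
    (hGZK : rank_eq_analyticRank_of_analyticRank_le_one)
    (hsq : Squarefree n) (h57 : n % 8 = 5 ∨ n % 8 = 7)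
    (hr : haveI := isElliptic_congruentNumberCurve hsq.ne_zero; (congruentNumberCurve n).analyticRank = 1)
    {s : ℕ} (hs : 2 ≤ s)
    (hsel : haveI := isElliptic_congruentNumberCurve hsq.ne_zero; Nat.card ((congruentNumberCurve n).selmerGroup 2) = 2 ^ (2 + s))
    {x y : ℚ} (hxy : (congruentNumberCurve n).toAffine.Nonsingular x y)
    (hR : haveI := isElliptic_congruentNumberCurve hsq.ne_zero;
      ∀ P, ∃ m : ℤ, IsOfFinAddOrder (P - m • (Point.some x y hxy : (congruentNumberCurve n).toAffine.Point)))
    (hx : ¬ ∃ q : ℚ, x = q ^ 2 ∨ x = -q ^ 2 ∨ x = n * q ^ 2 ∨ x = -(n * q ^ 2)) :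
    ∀ L : ℤ, IsScriptL n L → (2 : ℤ) ∣ L := by
  have h8 : n % 8 = 5 ∨ n % 8 = 6 ∨ n % 8 = 7 := by rcases h57 with h | h <;> omega
  obtain ⟨D, hPr, hCM⟩ := hF n hsq h8
  exact two_dvd_scriptL_rhoOne_odd_of_displays hGZK hsq h57 hr D hPr hCM h11 hs hsel hxy hR hx

/-- **`OfFacts` shape for the planner**: the conjunction of the three printed/named facts implies the lower half of C⁺ on the stratum `ρ(n) = 1` of the
odd `s ≥ 2` class. [cite: TianYuanZhang2017, Thm. 1.1, §1 (ρ(n)) and §3] [cite: HeathBrown1994SelmerCongruentII, Appendix (Monsky)] [cite: Darmon2004, Thm. 3.22] -/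
theorem two_dvd_scriptL_rhoOne_odd_of_facts :
    (tyz_cmPointRingClassFrobeniusData ∧ thm11_parity_of_scriptL ∧ rank_eq_analyticRank_of_analyticRank_le_one) →
      ∀ n : ℕ, (hsq : Squarefree n) → (n % 8 = 5 ∨ n % 8 = 7) →
        (haveI := isElliptic_congruentNumberCurve hsq.ne_zero; (congruentNumberCurve n).analyticRank = 1) →
        ∀ s : ℕ, 2 ≤ s →
          (haveI := isElliptic_congruentNumberCurve hsq.ne_zero; Nat.card ((congruentNumberCurve n).selmerGroup 2) = 2 ^ (2 + s)) →
          ∀ (x y : ℚ) (hxy : (congruentNumberCurve n).toAffine.Nonsingular x y),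
            (haveI := isElliptic_congruentNumberCurve hsq.ne_zero;
              ∀ P, ∃ m : ℤ, IsOfFinAddOrder (P - m • (Point.some x y hxy : (congruentNumberCurve n).toAffine.Point))) →
            (¬ ∃ q : ℚ, x = q ^ 2 ∨ x = -q ^ 2 ∨ x = n * q ^ 2 ∨ x = -(n * q ^ 2)) →
              ∀ L : ℤ, IsScriptL n L → (2 : ℤ) ∣ L :=
  fun h _ hsq h57 hr _ hs hsel _ _ hxy hR hx => two_dvd_scriptL_rhoOne_odd_of_facts' h.1 h.2.1 h.2.2 hsq h57 hr hs hsel hxy hR hx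

end Summit.BirchSwinnertonDyer.PrintCf2.LowerHalfRhoOne

end
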